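import Literature.IUT.LogVolume.ExplicitEstimatesTheorem53Proof
import Literature.NumberTheory.EllipticCurves.Szpiro
import HarnessLib

/-!
# [ExpEst] Remark 5.3.3: the explicit Szpiro inequality in CONDUCTOR form ("forme forte") for the
# Legendre curves `E_λ : y² = x(x−1)(x−λ)` over a mono-complex number field — typed as printed
# (CANDIDATE display), with the printed derivation from Theorem 5.3 (i) PROVED step by step

S. Mochizuki, I. Fesenko, Y. Hoshi, A. Minamide, W. Porowski, *Explicit estimates in inter-universal
Teichmüller theory*, Kodai Math. J. **45** (2022) 175–236 — [ExpEst], bib key `MochizukiEtAl2022` (D-0012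
claim key, status disputed) — **Remark 5.3.3**, journal p. 222 l. 14 – p. 223 l. 4 (= pdf p48.l14 – p49.l4
of the cell render `run/shared/lean/pub/abc-iut/plan/repair/lit/renders/MFHMP-ExplicitEstimates-Kodai2022-
book-anonnd-eeiutp`; journal page = pdf page + 174; word-identical with the kurims manuscript
`paper:url-282b4741d9d5`, p. 45 l. 32 – p. 46 l. 21).

TAKES NO SIDE on [IUTchIII] Corollary 3.12 or on any author. Remark 5.3.3 is DOWNSTREAM of Theorem
5.3 (i) (proved in print from Cor. 5.2 ⟸ Thm. 5.1 ⟸ the μ₆-version of [IUTchIII] Cor. 3.12, whose proof is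
disputed [cite: ScholzeStix2018, §2.2 p. 10]); accordingly its displayed inequality is typed as a claim-
tagged CANDIDATE predicate in `(L, λ, ε)` (never asserted, never a Literature fact), and what this file
PROVES is only the real-arithmetic passage "(R1) + (R0) + Theorem 5.3 (i) ⟹ display", with the two
classical inputs (R1) (local comparison) and (R0) (`N(𝔣) ≥ rad`) taken as EXPLICIT HYPOTHESES (the
predicates `Rmk533LocalBound`, `Rmk533RadLeConductor`, quoted verbatim; not proved here, not minted as
facts). Typed ≠ proved ≠ endorsed; no abc claim; no Szpiro claim.

Printed text (p. 222 l. 14 – p. 223 l. 4): "**Remark 5.3.3.** In the notation of Theorem 5.3, let `λ ∈ L^⑂`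
[`= L ∖ {0, 1}`]. Write `E_λ` for the elliptic curve over `L` defined by the equation `y² = x(x−1)(x−λ)`;
`𝔇_{E_λ}` (respectively, `𝔣_{E_λ}`) for the *minimal discriminant ideal* [cf. [Silv1], Chapter VIII, §8, the
first Definition] (respectively, *conductor ideal* [cf. [Silv2], Chapter IV, §10, the Definition preceding
Example 10.5]) of `E_λ` over `L`. Let us first observe that `E_λ` has semi-stable reduction at every place
`v ∈ 𝕍(L)^non` such that `λ` is integral at `v`, and `v` does not divide `2`. If `v ∈ 𝕍(L)^non` is such that `λ`
is not integral at `v`, then observe the following: There exists an element `u ∈ L^×` such that `u = λw²` for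
some `w ∈ L^×`, and, moreover, `u` is a unit or a uniformizer at `v`. Thus, `E_λ` is defined by the equation
`(y′)² = x′(x′−u)(x′−uλ′)`, where we write `λ′ := λ⁻¹ ∈ L^×` [so `u` and `uλ′` are integral at `v`], `x′ := uλ′x`,
and `y′ := w³y`. In particular, by applying a similar argument to the argument applied in [Silv1], Chapter
VII, §5, the proof of Proposition 5.4, we obtain that
  (R1) `log(N_{L/ℚ}(𝔇_{E_λ})) ≤ d·h_non(j(E_λ)) + 6(log(N_{L/ℚ}(𝔣_{E_λ})) − log(rad_L(a,b,c))) + d·(8 − (−4)) log 2`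
— where we take “`a`” (respectively, “`b`”; “`c`”) to be `λ` (respectively, `1 − λ`; `−1`); we write
“`N_{L/ℚ}(−)`” for the absolute norm of the ideal `(−)` of `𝒪_L`; we recall that
  (R0) `N_{L/ℚ}(𝔣_{E_λ}) ≥ rad_L(a,b,c)`
[cf. Remark 1.10.1; [Silv1], Chapter III, §1, Proposition 1.7, (b), and its proof; [Silv2], Chapter IV,
§10, Theorem 10.2, (a); [Silv2], Chapter IV, §10, Example 10.5; [Silv2], Chapter IV, §11, Ogg’s Formula
11.1 and its proof]. Then it follows immediately from Theorem 5.3, (i), that we have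
  (R2) `N_{L/ℚ}(𝔇_{E_λ}) ≤ 2^{12d}·max{Δ_L^{6(1+ε)}·N_{L/ℚ}(𝔣_{E_λ})^{6(1+ε)}, exp(d·h_d(ε))}`
  (R3) `≤ 2^{12d}·Δ_L^{6(1+ε)}·exp(d·h_d(ε))·N_{L/ℚ}(𝔣_{E_λ})^{6(1+ε)}`.
This may be regarded as an explicit version of the inequality “`Norme_{K/ℚ}(Δ_E) ≤ C(K,ε)(Norme_{K/ℚ}
(N_E))^{6+ε}`” conjectured in [Szp], §1, CONJECTURE 1 forme forte, in the case of `L` and `E_λ` as above."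
([Silv1] = Silverman AEC, [Silv2] = Silverman ATAEC, [Szp] = Szpiro, Astérisque 183 (1990).)

## Rendering of the printed nouns (tree vocabulary, cited BY NAME; nothing re-declared)

* `E_λ` = the literal Weierstrass equation `⟨0, −(1 + λ), 0, λ, 0⟩ : WeierstrassCurve L` used throughout the
  tree's Legendre files (`NFPoint.legendreCurve` in `GenEllRemarks44`, `LegendreFormValuation`,
  `LegendreSemistableReductionProofs`).
* `N_{L/ℚ}(𝔇_{E_λ})` = `WeierstrassCurve.minimalDiscriminantNorm (𝓞 L) E_λ`, `N_{L/ℚ}(𝔣_{E_λ})` =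
  `WeierstrassCurve.conductorNorm (𝓞 L) E_λ` (`Literature/NumberTheory/DiophantineGeometry/MinimalDiscriminant
  .lean`, `…/Conductor.lean`: absolute norms of the minimal discriminant ideal and of the conductor ideal —
  Ogg's formula — of a Weierstrass equation over the fraction field of the Dedekind domain `𝓞 L`); these are
  EXACTLY the two quantities of the tree's `SzpiroConjectureOver L` (`Literature/NumberTheory/EllipticCurves/
  Szpiro.lean`, Silverman ATAEC Conj. IV.10.6). Abbreviated below as `legendreMinDiscNorm λ`,
  `legendreCondNorm λ` (unfolding lemmas `rfl`).
* `d`, `Δ_L`, `rad_L(a,b,c)`, `h_non`, `h_d(ε)`, `j(E_λ)`, "mono-complex", Theorem 5.3 (i): the lineage's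
  `Module.finrank ℚ L`, `ExpEst.absDisc`, `ExpEst.radL`, `ExpEst.hNon`, `ExpEst.hd`, `Cor22.jInv λ`
  (`j(E_{a,b,c}) = jInv(−a/c) = jInv λ` for `(a,b,c) = (λ, 1−λ, −1)`), `ExpEst.IsMonoComplex`, `ExpEst.Thm53i`.

## What is typed (§1), what is PROVED (§2–§3), and what the kernel does NOT reach (neutral bookkeeping)

§1 `Rmk533LocalBound` = (R1) and `Rmk533RadLeConductor` = (R0), the two CLASSICAL inputs, as predicates
(hypotheses: the place-by-place analysis of `𝔇_{E_λ}` is not re-done here; the tree's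
`LegendreSemistableReductionProofs` / `LegendreFormMultiplicativeProofs` / `LegendreSemistableBaseChange
Proofs` cover the odd places); `Rmk533` = (R2) (the display, `max` form, AS PRINTED) and `Rmk533Product` =
(R3), claim-tagged CANDIDATES. §2 PROVED (pure real arithmetic): `log_minDisc_le_of_thm53i` — (R1) + Theorem
5.3 (i) give `log N(𝔇) ≤ 12d·log 2 + max{6(1+ε)·log(Δ_L·rad_L), d·h_d(ε)} + 6(log N(𝔣) − log rad_L)`;
`rmk533Product_of_thm53i` — with (R0): (R3) follows; `rmk533_of_thm53i_of_rad_eq` — with `rad_L = N(𝔣)`: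
(R2) follows; `rmk533Product_of_rmk533` — (R2) ⟹ (R3) ("`max ≤ product`", both entries `≥ 1`). READING
NOTE (bookkeeping, no judgement): by this bookkeeping alone the kernel reaches the first printed line (R2)
only under `rad_L = N(𝔣)`: when the second entry of the `max` dominates, the intermediate bound exceeds the
right side of (R2) by `6·log(N(𝔣)/rad_L) ≥ 0`; the second line (R3) is reached from (R0) as printed. The
recalled inequality (R0) enters ONLY as a hypothesis (a reading note on (R0) at `L = ℚ`, `λ = −9/16` is kept
in the seat's faithfulness sheet `HOME/lit-abc-explicitiut/F29-LOCATOR-FAITHFULNESS.md`, outside the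
kernel). §3 PROVED: the Szpiro SHAPE — (R3) for every `λ ∈ L^⑂` and every `ε ∈ (0,1]` yields, for every
`ε′ > 0`, a constant `C(L, ε′)` with `N(𝔇_{E_λ}) ≤ C·N(𝔣_{E_λ})^{6+ε′}` on the whole Legendre family over `L`
(`szpiroShape_legendre_of_rmk533Product`), i.e. the restriction of the tree's `SzpiroConjectureOver L` to the
equations `⟨0, −(1+λ), 0, λ, 0⟩` — the precise content of "an explicit version of … CONJECTURE 1 forme
forte, in the case of `L` and `E_λ`" (the full conjecture quantifies over ALL elliptic `W/L`).

Deliberately NOT here: a proof of (R1) (place-by-place minimal-discriminant analysis); Remark 5.3.4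
(Legendre form vs. rational `2`-torsion); Remark 5.3.5 ([HS] Thm 0.3 / Lang's conjecture: no formula is
printed); any judgement on Cor. 3.12, Thm. 5.3, or Szpiro's conjecture.
-/

noncomputable section

namespace Literature.IUT.LogVolume

namespace ExpEst

open NumberField Real Cor22

variable {L : Type*} [Field L] [NumberField L]

/-! ## 0. The two norms of Remark 5.3.3 for `E_λ = ⟨0, −(1+λ), 0, λ, 0⟩` (tree notions, specialised) -/

/-- "`𝔇_{E_λ}` … the minimal discriminant ideal … of `E_λ` over `L`", "`N_{L/ℚ}(−)` for the absolute norm of the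
ideal `(−)` of `𝒪_L`" (p. 222 l. 15–18, 39): `N_{L/ℚ}(𝔇_{E_λ})` = the tree's
`WeierstrassCurve.minimalDiscriminantNorm (𝓞 L)` of the Legendre equation `y² = x(x−1)(x−λ)`.
[cite: MochizukiEtAl2022, Rmk 5.3.3 p. 222 l. 15–18] -/
def legendreMinDiscNorm (lam : L) : ℕ :=
  (⟨0, -(1 + lam), 0, lam, 0⟩ : WeierstrassCurve L).minimalDiscriminantNorm (𝓞 L)

/-- "`𝔣_{E_λ}` … conductor ideal [cf. [Silv2], Chapter IV, §10] of `E_λ` over `L`" (p. 222 l. 15–18):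
`N_{L/ℚ}(𝔣_{E_λ})` = the tree's `WeierstrassCurve.conductorNorm (𝓞 L)` (Ogg's formula) of `y² = x(x−1)(x−λ)`.
[cite: MochizukiEtAl2022, Rmk 5.3.3 p. 222 l. 15–18] -/
def legendreCondNorm (lam : L) : ℕ :=
  (⟨0, -(1 + lam), 0, lam, 0⟩ : WeierstrassCurve L).conductorNorm (𝓞 L)

/-- Unfolding (definitional). [cite: MochizukiEtAl2022, Rmk 5.3.3 p. 222] -/
theorem legendreMinDiscNorm_def (lam : L) : legendreMinDiscNorm lam =
    (⟨0, -(1 + lam), 0, lam, 0⟩ : WeierstrassCurve L).minimalDiscriminantNorm (𝓞 L) := rfl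

/-- Unfolding (definitional). [cite: MochizukiEtAl2022, Rmk 5.3.3 p. 222] -/
theorem legendreCondNorm_def (lam : L) : legendreCondNorm lam =
    (⟨0, -(1 + lam), 0, lam, 0⟩ : WeierstrassCurve L).conductorNorm (𝓞 L) := rfl

/-- `N_{L/ℚ}(𝔣_{E_λ}) ≥ 1`: the conductor ideal is a non-zero ideal of `𝓞 L` (the tree's
`WeierstrassCurve.conductor_ne_bot`), so its absolute norm is a positive integer (Silverman ATAEC IV.10, the
conductor ideal is an integral ideal `∏ 𝔭_v^{f_v}`). [cite: Silverman1994, §IV.10 (Definition preceding Example 10.5)] -/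
theorem legendreCondNorm_pos (lam : L) : 0 < legendreCondNorm lam := by
  rw [legendreCondNorm, Nat.pos_iff_ne_zero, WeierstrassCurve.conductorNorm, Ne, Ideal.absNorm_eq_zero_iff]
  exact WeierstrassCurve.conductor_ne_bot (𝓞 L) _

/-! ## 1. The classical inputs (R1), (R0) and the displayed inequality (R2)/(R3), typed as printed -/

/-- **(R1), the local comparison of Remark 5.3.3** (p. 222 l. 34–37): "by applying a similar argument to the
argument applied in [Silv1], Chapter VII, §5, the proof of Proposition 5.4, we obtain that
`log(N_{L/ℚ}(𝔇_{E_λ})) ≤ d·h_non(j(E_λ)) + 6(log(N_{L/ℚ}(𝔣_{E_λ})) − log(rad_L(a,b,c))) + d·(8 − (−4)) log 2`" with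
`(a,b,c) = (λ, 1−λ, −1)`, `d = [L:ℚ]`, `j(E_λ) = jInv λ`. CLASSICAL content (no Θ-data, nothing disputed),
typed VERBATIM as a predicate in `(L, λ)` and used below as a HYPOTHESIS; not proved in this file.
[cite: MochizukiEtAl2022, Rmk 5.3.3 p. 222 l. 34–37] -/
def Rmk533LocalBound (lam : L) : Prop :=
  Real.log (legendreMinDiscNorm lam : ℝ) ≤
    (Module.finrank ℚ L : ℝ) * hNon (jInv lam) +
      6 * (Real.log (legendreCondNorm lam : ℝ) - Real.log (radL lam (1 - lam) (-1) : ℝ)) +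
      (Module.finrank ℚ L : ℝ) * (8 - (-4)) * Real.log 2

/-- **(R0), the recalled inequality of Remark 5.3.3** (p. 222 l. 39–42): "we recall that `N_{L/ℚ}(𝔣_{E_λ}) ≥
rad_L(a,b,c)` [cf. Remark 1.10.1; [Silv1], Chapter III, §1, Proposition 1.7, (b), and its proof; [Silv2],
Chapter IV, §10, Theorem 10.2, (a); … Example 10.5; … Ogg’s Formula 11.1 and its proof]", `(a,b,c) = (λ,
1−λ, −1)`, `rad_L` as defined in Theorem 5.3 (`ExpEst.radL`). Typed VERBATIM as a predicate in `(L, λ)` and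
used below as a HYPOTHESIS. [cite: MochizukiEtAl2022, Rmk 5.3.3 p. 222 l. 39–42] -/
def Rmk533RadLeConductor (lam : L) : Prop :=
  (radL lam (1 - lam) (-1) : ℝ) ≤ (legendreCondNorm lam : ℝ)

/-- **[ExpEst] Remark 5.3.3, the displayed inequality, first line (R2)** (p. 222 l. 43–45): "it follows
immediately from Theorem 5.3, (i), that we have `N_{L/ℚ}(𝔇_{E_λ}) ≤ 2^{12d}·max{Δ_L^{6(1+ε)}·N_{L/ℚ}(𝔣_{E_λ})
^{6(1+ε)}, exp(d·h_d(ε))}`" — in the notation of Theorem 5.3: `L` mono-complex, `λ ∈ L^⑂` (`λ ≠ 0, 1`), `0 < ε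
≤ 1`, `d = [L:ℚ]`. AS PRINTED (`max` form). Downstream of Theorem 5.3 (i), hence of the disputed Cor. 3.12: a
CANDIDATE predicate in `(L, λ, ε)`; never asserted. [claim: MochizukiEtAl2022, status: disputed] -/
@[claim "MochizukiEtAl2022" "disputed"]
def Rmk533 (L : Type*) [Field L] [NumberField L] (lam : L) (ε : ℝ) : Prop :=
  IsMonoComplex L → lam ≠ 0 → lam ≠ 1 → 0 < ε → ε ≤ 1 →
    (legendreMinDiscNorm lam : ℝ) ≤
      (2 : ℝ) ^ (12 * Module.finrank ℚ L) *
        max ((absDisc L : ℝ) ^ (6 * (1 + ε)) * (legendreCondNorm lam : ℝ) ^ (6 * (1 + ε)))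
          (Real.exp ((Module.finrank ℚ L : ℝ) * hd (Module.finrank ℚ L) ε))

/-- **[ExpEst] Remark 5.3.3, the displayed inequality, second line (R3)** (p. 222 l. 46–47): "`≤ 2^{12d}·
Δ_L^{6(1+ε)}·exp(d·h_d(ε))·N_{L/ℚ}(𝔣_{E_λ})^{6(1+ε)}`" (same hypotheses) — the product form, which print
regards as "an explicit version of the inequality “`Norme_{K/ℚ}(Δ_E) ≤ C(K,ε)(Norme_{K/ℚ}(N_E))^{6+ε}`” … of
[Szp], §1 [forme forte], in the case of `L` and `E_λ` as above" (p. 223 l. 1–4; the Szpiro SHAPE is drawn in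
`szpiroShape_legendre_of_rmk533Product`). A printed CLAIMED consequence of Theorem 5.3 (i), typed as a
CANDIDATE predicate in `(L, λ, ε)`; never asserted. [claim: MochizukiEtAl2022, status: disputed] -/
@[claim "MochizukiEtAl2022" "disputed"]
def Rmk533Product (L : Type*) [Field L] [NumberField L] (lam : L) (ε : ℝ) : Prop :=
  IsMonoComplex L → lam ≠ 0 → lam ≠ 1 → 0 < ε → ε ≤ 1 →
    (legendreMinDiscNorm lam : ℝ) ≤
      (2 : ℝ) ^ (12 * Module.finrank ℚ L) * (absDisc L : ℝ) ^ (6 * (1 + ε)) *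
        Real.exp ((Module.finrank ℚ L : ℝ) * hd (Module.finrank ℚ L) ε) *
          (legendreCondNorm lam : ℝ) ^ (6 * (1 + ε))

/-! ## 2. The printed derivation, PROVED -/

/-- `h_d(ε) ≥ 0` for `ε > 0` (all three branches of the printed definition are products of positive
constants, a real power of `ε > 0`, and `d⁵ ≥ 0`). [cite: MochizukiEtAl2022, Cor 5.2 p. 211] -/
theorem hd_nonneg (d : ℕ) {ε : ℝ} (hε : 0 < ε) : 0 ≤ hd d ε := by
  unfold hd
  have h1 : 0 ≤ ε ^ (-(166 : ℝ) / 81) := (Real.rpow_pos_of_pos hε _).le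
  have h2 : 0 ≤ ε ^ (-(174 : ℝ) / 85) := (Real.rpow_pos_of_pos hε _).le
  split_ifs <;> positivity

/-- A natural number whose logarithm is at most `log y`, `y > 0`, is at most `y` (private plumbing). [folklore] -/
private theorem natCast_le_of_log_le {n : ℕ} {y : ℝ} (hy : 0 < y) (h : Real.log (n : ℝ) ≤ Real.log y) :
    (n : ℝ) ≤ y := by
  rcases Nat.eq_zero_or_pos n with hn | hn
  · rw [hn, Nat.cast_zero]; exact hy.le
  · exact (Real.log_le_log_iff (by exact_mod_cast hn) hy).1 h

/-- **First step of the printed derivation**: from (R1) and Theorem 5.3 (i) at `(a,b,c) = (λ, 1−λ, −1)` (so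
`a + b + c = 0` and `j(E_{a,b,c}) = jInv(−a/c) = jInv λ`), for `L` mono-complex, `λ ≠ 0, 1`, `0 < ε ≤ 1`:
`log N(𝔇_{E_λ}) ≤ 12d·log 2 + max{6(1+ε)·log(Δ_L·rad_L), d·h_d(ε)} + 6·(log N(𝔣_{E_λ}) − log rad_L)`. Pure real
arithmetic (`d·(8 − (−4)) = 12d`; `d·max{d⁻¹(1+ε)·X, h_d/6}·6 = max{6(1+ε)X, d·h_d}`).
[cite: MochizukiEtAl2022, Rmk 5.3.3 p. 222] -/
theorem log_minDisc_le_of_thm53i {lam : L} {ε : ℝ} (hL : IsMonoComplex L) (h0 : lam ≠ 0) (h1 : lam ≠ 1)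
    (hε : 0 < ε) (hε1 : ε ≤ 1) (hR1 : Rmk533LocalBound lam) (h53 : Thm53i L lam (1 - lam) (-1) ε) :
    Real.log (legendreMinDiscNorm lam : ℝ) ≤
      12 * (Module.finrank ℚ L : ℝ) * Real.log 2 +
        max (6 * (1 + ε) * Real.log ((absDisc L : ℝ) * (radL lam (1 - lam) (-1) : ℝ)))
            ((Module.finrank ℚ L : ℝ) * hd (Module.finrank ℚ L) ε) +
        6 * (Real.log (legendreCondNorm lam : ℝ) - Real.log (radL lam (1 - lam) (-1) : ℝ)) := by
  have hb : (1 : L) - lam ≠ 0 := sub_ne_zero.2 (Ne.symm h1)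
  have hc : (-1 : L) ≠ 0 := neg_ne_zero.2 one_ne_zero
  have hsum : lam + (1 - lam) + (-1) = 0 := by ring
  have h53' := h53 hL h0 hb hc hsum hε hε1
  have hj : -(lam / (-1 : L)) = lam := by rw [div_neg, div_one, neg_neg]
  rw [hj] at h53'
  have hd0 : (0 : ℝ) < (Module.finrank ℚ L : ℝ) := by
    exact_mod_cast Module.finrank_pos (R := ℚ) (M := L)
  -- `d · h_non(j) ≤ max{6(1+ε)·log(Δ·rad), d·h_d}`
  have hmax : (Module.finrank ℚ L : ℝ) * hNon (jInv lam) ≤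
      max (6 * (1 + ε) * Real.log ((absDisc L : ℝ) * (radL lam (1 - lam) (-1) : ℝ)))
        ((Module.finrank ℚ L : ℝ) * hd (Module.finrank ℚ L) ε) := by
    rcases le_total ((Module.finrank ℚ L : ℝ)⁻¹ * (1 + ε) *
        Real.log ((absDisc L : ℝ) * (radL lam (1 - lam) (-1) : ℝ)))
      (1 / 6 * hd (Module.finrank ℚ L) ε) with hAB | hBA
    · rw [max_eq_right hAB] at h53'
      have : (Module.finrank ℚ L : ℝ) * hNon (jInv lam) ≤
          (Module.finrank ℚ L : ℝ) * hd (Module.finrank ℚ L) ε :=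
        mul_le_mul_of_nonneg_left (by linarith) hd0.le
      exact this.trans (le_max_right _ _)
    · rw [max_eq_left hBA] at h53'
      have h6 : hNon (jInv lam) ≤ 6 * ((Module.finrank ℚ L : ℝ)⁻¹ * (1 + ε) *
          Real.log ((absDisc L : ℝ) * (radL lam (1 - lam) (-1) : ℝ))) := by linarith
      have : (Module.finrank ℚ L : ℝ) * hNon (jInv lam) ≤
          6 * (1 + ε) * Real.log ((absDisc L : ℝ) * (radL lam (1 - lam) (-1) : ℝ)) := by
        calc (Module.finrank ℚ L : ℝ) * hNon (jInv lam)
            ≤ (Module.finrank ℚ L : ℝ) * (6 * ((Module.finrank ℚ L : ℝ)⁻¹ * (1 + ε) *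
                Real.log ((absDisc L : ℝ) * (radL lam (1 - lam) (-1) : ℝ)))) :=
              mul_le_mul_of_nonneg_left h6 hd0.le
          _ = 6 * (1 + ε) * Real.log ((absDisc L : ℝ) * (radL lam (1 - lam) (-1) : ℝ)) := by
              field_simp
      exact this.trans (le_max_left _ _)
  have hR1' := hR1
  unfold Rmk533LocalBound at hR1'
  have h12 : (Module.finrank ℚ L : ℝ) * (8 - (-4)) * Real.log 2 =
      12 * (Module.finrank ℚ L : ℝ) * Real.log 2 := by ring
  linarith

/-- **The second printed line (R3), PROVED from (R1), (R0) and Theorem 5.3 (i)** ("Then it follows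
immediately from Theorem 5.3, (i), that we have … `≤ 2^{12d}·Δ_L^{6(1+ε)}·exp(d·h_d(ε))·N_{L/ℚ}(𝔣_{E_λ})^{6(1+ε)}`",
p. 222 l. 42–47): `max{X, Y} ≤ X + Y` (`X = 6(1+ε)·log(Δ_L·rad_L) ≥ 0`, `Y = d·h_d ≥ 0`), `log(Δ_L·rad_L) = log Δ_L
+ log rad_L`, and `6ε·log rad_L ≤ 6ε·log N(𝔣)` by (R0); then exponentiate. A conditional theorem: it
discharges nothing it binds. [cite: MochizukiEtAl2022, Rmk 5.3.3 p. 222 l. 42–47] -/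
theorem rmk533Product_of_thm53i {lam : L} {ε : ℝ} (hR1 : Rmk533LocalBound lam)
    (hR0 : Rmk533RadLeConductor lam) (h53 : Thm53i L lam (1 - lam) (-1) ε) : Rmk533Product L lam ε := by
  intro hL h0 h1 hε hε1
  have hlog := log_minDisc_le_of_thm53i hL h0 h1 hε hε1 hR1 h53
  unfold Rmk533RadLeConductor at hR0
  -- positivity of the nouns
  have hR : (1 : ℝ) ≤ (radL lam (1 - lam) (-1) : ℝ) := by exact_mod_cast one_le_radL lam (1 - lam) (-1)
  have hΔ : (1 : ℝ) ≤ (absDisc L : ℝ) := by exact_mod_cast one_le_absDisc L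
  have hN : (1 : ℝ) ≤ (legendreCondNorm lam : ℝ) := hR.trans hR0
  have hRpos : (0 : ℝ) < (radL lam (1 - lam) (-1) : ℝ) := by linarith
  have hΔpos : (0 : ℝ) < (absDisc L : ℝ) := by linarith
  have hNpos : (0 : ℝ) < (legendreCondNorm lam : ℝ) := by linarith
  have hd0 : (0 : ℝ) < (Module.finrank ℚ L : ℝ) := by
    exact_mod_cast Module.finrank_pos (R := ℚ) (M := L)
  have hhd : 0 ≤ hd (Module.finrank ℚ L) ε := hd_nonneg _ hε
  -- logs
  have hlogR : 0 ≤ Real.log (radL lam (1 - lam) (-1) : ℝ) := Real.log_nonneg hR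
  have hlogΔ : 0 ≤ Real.log (absDisc L : ℝ) := Real.log_nonneg hΔ
  have hlogRN : Real.log (radL lam (1 - lam) (-1) : ℝ) ≤ Real.log (legendreCondNorm lam : ℝ) :=
    Real.log_le_log hRpos hR0
  have hlogmul : Real.log ((absDisc L : ℝ) * (radL lam (1 - lam) (-1) : ℝ)) =
      Real.log (absDisc L : ℝ) + Real.log (radL lam (1 - lam) (-1) : ℝ) :=
    Real.log_mul hΔpos.ne' hRpos.ne'
  have hmaxle : max (6 * (1 + ε) * Real.log ((absDisc L : ℝ) * (radL lam (1 - lam) (-1) : ℝ)))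
        ((Module.finrank ℚ L : ℝ) * hd (Module.finrank ℚ L) ε) ≤
      6 * (1 + ε) * (Real.log (absDisc L : ℝ) + Real.log (radL lam (1 - lam) (-1) : ℝ)) +
        (Module.finrank ℚ L : ℝ) * hd (Module.finrank ℚ L) ε := by
    rw [hlogmul]
    refine max_le ?_ ?_
    · have : 0 ≤ (Module.finrank ℚ L : ℝ) * hd (Module.finrank ℚ L) ε := mul_nonneg hd0.le hhd
      linarith
    · have : 0 ≤ 6 * (1 + ε) * (Real.log (absDisc L : ℝ) + Real.log (radL lam (1 - lam) (-1) : ℝ)) := by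
        positivity
      linarith
  -- the logarithm of the right-hand side of (R3)
  set RHS := (2 : ℝ) ^ (12 * Module.finrank ℚ L) * (absDisc L : ℝ) ^ (6 * (1 + ε)) *
    Real.exp ((Module.finrank ℚ L : ℝ) * hd (Module.finrank ℚ L) ε) *
      (legendreCondNorm lam : ℝ) ^ (6 * (1 + ε)) with hRHS
  have hRHSpos : 0 < RHS := by positivity
  have hlogRHS : Real.log RHS = 12 * (Module.finrank ℚ L : ℝ) * Real.log 2 +
      6 * (1 + ε) * Real.log (absDisc L : ℝ) + (Module.finrank ℚ L : ℝ) * hd (Module.finrank ℚ L) ε +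
        6 * (1 + ε) * Real.log (legendreCondNorm lam : ℝ) := by
    have h2pow : (0 : ℝ) < (2 : ℝ) ^ (12 * Module.finrank ℚ L) := by positivity
    have hΔpow : (0 : ℝ) < (absDisc L : ℝ) ^ (6 * (1 + ε)) := Real.rpow_pos_of_pos hΔpos _
    have hexp : (0 : ℝ) < Real.exp ((Module.finrank ℚ L : ℝ) * hd (Module.finrank ℚ L) ε) :=
      Real.exp_pos _
    have hNpow : (0 : ℝ) < (legendreCondNorm lam : ℝ) ^ (6 * (1 + ε)) := Real.rpow_pos_of_pos hNpos _
    rw [hRHS, Real.log_mul (by positivity) hNpow.ne', Real.log_mul (by positivity) hexp.ne',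
      Real.log_mul h2pow.ne' hΔpow.ne', Real.log_pow, Real.log_rpow hΔpos, Real.log_exp,
      Real.log_rpow hNpos]
    push_cast
    ring
  have hεlog : 6 * ε * Real.log (radL lam (1 - lam) (-1) : ℝ) ≤ 6 * ε * Real.log (legendreCondNorm lam : ℝ) :=
    mul_le_mul_of_nonneg_left hlogRN (by linarith)
  have hfinal : Real.log (legendreMinDiscNorm lam : ℝ) ≤ Real.log RHS := by
    rw [hlogRHS]; nlinarith
  exact natCast_le_of_log_le hRHSpos hfinal

/-- **The first printed line (R2) under `rad_L(λ, 1−λ, −1) = N(𝔣_{E_λ})`** (the case in which (R0) is an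
equality — e.g. every place in `I_L` is a place of multiplicative reduction of `E_λ` and conversely): then the
term `6(log N(𝔣) − log rad_L)` of (R1) vanishes and `log N(𝔇) ≤ 12d·log 2 + max{6(1+ε)·log(Δ_L·N(𝔣)), d·h_d}`,
which exponentiates to the `max` form (R2). This is the hypothesis under which the bookkeeping of this file
reaches the first printed line; the second line (R3) needs only (R0) (`rmk533Product_of_thm53i`). A
conditional theorem. [cite: MochizukiEtAl2022, Rmk 5.3.3 p. 222 l. 42–45] -/
theorem rmk533_of_thm53i_of_rad_eq {lam : L} {ε : ℝ} (hR1 : Rmk533LocalBound lam)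
    (hrad : (radL lam (1 - lam) (-1) : ℝ) = (legendreCondNorm lam : ℝ))
    (h53 : Thm53i L lam (1 - lam) (-1) ε) : Rmk533 L lam ε := by
  intro hL h0 h1 hε hε1
  have hlog := log_minDisc_le_of_thm53i hL h0 h1 hε hε1 hR1 h53
  rw [hrad, sub_self, mul_zero, add_zero] at hlog
  have hΔ : (1 : ℝ) ≤ (absDisc L : ℝ) := by exact_mod_cast one_le_absDisc L
  have hN : (1 : ℝ) ≤ (legendreCondNorm lam : ℝ) := by exact_mod_cast legendreCondNorm_pos lam
  have hΔpos : (0 : ℝ) < (absDisc L : ℝ) := by linarith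
  have hNpos : (0 : ℝ) < (legendreCondNorm lam : ℝ) := by linarith
  have h2pow : (0 : ℝ) < (2 : ℝ) ^ (12 * Module.finrank ℚ L) := by positivity
  set P := (absDisc L : ℝ) ^ (6 * (1 + ε)) * (legendreCondNorm lam : ℝ) ^ (6 * (1 + ε)) with hP
  set Q := Real.exp ((Module.finrank ℚ L : ℝ) * hd (Module.finrank ℚ L) ε) with hQ
  have hPpos : 0 < P := by rw [hP]; exact mul_pos (Real.rpow_pos_of_pos hΔpos _) (Real.rpow_pos_of_pos hNpos _)
  have hQpos : 0 < Q := Real.exp_pos _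
  have hlogP : Real.log ((2 : ℝ) ^ (12 * Module.finrank ℚ L) * P) =
      12 * (Module.finrank ℚ L : ℝ) * Real.log 2 +
        6 * (1 + ε) * Real.log ((absDisc L : ℝ) * (legendreCondNorm lam : ℝ)) := by
    rw [Real.log_mul h2pow.ne' hPpos.ne', hP, Real.log_mul (Real.rpow_pos_of_pos hΔpos _).ne'
      (Real.rpow_pos_of_pos hNpos _).ne', Real.log_pow, Real.log_rpow hΔpos, Real.log_rpow hNpos,
      Real.log_mul hΔpos.ne' hNpos.ne']
    push_cast; ring
  have hlogQ : Real.log ((2 : ℝ) ^ (12 * Module.finrank ℚ L) * Q) =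
      12 * (Module.finrank ℚ L : ℝ) * Real.log 2 + (Module.finrank ℚ L : ℝ) * hd (Module.finrank ℚ L) ε := by
    rw [Real.log_mul h2pow.ne' hQpos.ne', hQ, Real.log_pow, Real.log_exp]; push_cast; ring
  rcases le_total (6 * (1 + ε) * Real.log ((absDisc L : ℝ) * (legendreCondNorm lam : ℝ)))
      ((Module.finrank ℚ L : ℝ) * hd (Module.finrank ℚ L) ε) with hXY | hYX
  · rw [max_eq_right hXY] at hlog
    have h' : (legendreMinDiscNorm lam : ℝ) ≤ (2 : ℝ) ^ (12 * Module.finrank ℚ L) * Q :=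
      natCast_le_of_log_le (mul_pos h2pow hQpos) (by rw [hlogQ]; linarith)
    exact h'.trans (mul_le_mul_of_nonneg_left (le_max_right P Q) h2pow.le)
  · rw [max_eq_left hYX] at hlog
    have h' : (legendreMinDiscNorm lam : ℝ) ≤ (2 : ℝ) ^ (12 * Module.finrank ℚ L) * P :=
      natCast_le_of_log_le (mul_pos h2pow hPpos) (by rw [hlogP]; linarith)
    exact h'.trans (mul_le_mul_of_nonneg_left (le_max_left P Q) h2pow.le)

/-- **(R2) ⟹ (R3)** (the printed "`≤`" between the two lines, p. 222 l. 45–47): "`C·max{P, Q} ≤ C·P·Q`" for `C ≥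
0` and `P, Q ≥ 1` — here `P = Δ_L^{6(1+ε)}·N(𝔣)^{6(1+ε)} ≥ 1` (`Δ_L, N(𝔣) ≥ 1`, exponent `≥ 0`) and `Q = exp(d·
h_d(ε)) ≥ 1` (`h_d ≥ 0`); the lineage's `thm53ii_product_form`. [cite: MochizukiEtAl2022, Rmk 5.3.3 p. 222 l. 45–47] -/
theorem rmk533Product_of_rmk533 {lam : L} {ε : ℝ} (H : Rmk533 L lam ε) : Rmk533Product L lam ε := by
  intro hL h0 h1 hε hε1
  have h := H hL h0 h1 hε hε1
  have hΔ : (1 : ℝ) ≤ (absDisc L : ℝ) := by exact_mod_cast one_le_absDisc L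
  have hN : (1 : ℝ) ≤ (legendreCondNorm lam : ℝ) := by exact_mod_cast legendreCondNorm_pos lam
  have hexp : 0 ≤ 6 * (1 + ε) := by linarith
  have hP : (1 : ℝ) ≤ (absDisc L : ℝ) ^ (6 * (1 + ε)) * (legendreCondNorm lam : ℝ) ^ (6 * (1 + ε)) :=
    one_le_mul_of_one_le_of_one_le (Real.one_le_rpow hΔ hexp) (Real.one_le_rpow hN hexp)
  have hQ : (1 : ℝ) ≤ Real.exp ((Module.finrank ℚ L : ℝ) * hd (Module.finrank ℚ L) ε) := by
    have h0' : 0 ≤ (Module.finrank ℚ L : ℝ) * hd (Module.finrank ℚ L) ε :=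
      mul_nonneg (Nat.cast_nonneg _) (hd_nonneg _ hε)
    have := Real.add_one_le_exp ((Module.finrank ℚ L : ℝ) * hd (Module.finrank ℚ L) ε)
    linarith
  have h' := thm53ii_product_form (by positivity) hP hQ h
  calc (legendreMinDiscNorm lam : ℝ)
      ≤ (2 : ℝ) ^ (12 * Module.finrank ℚ L) *
          ((absDisc L : ℝ) ^ (6 * (1 + ε)) * (legendreCondNorm lam : ℝ) ^ (6 * (1 + ε))) *
          Real.exp ((Module.finrank ℚ L : ℝ) * hd (Module.finrank ℚ L) ε) := h'
    _ = _ := by ring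

/-! ## 3. "An explicit version of … CONJECTURE 1 forme forte, in the case of `L` and `E_λ`" — the Szpiro
SHAPE on the Legendre family, PROVED from (R3) -/

/-- **Szpiro's inequality (Silverman ATAEC Conj. IV.10.6, the tree's `SzpiroConjectureOver L`) RESTRICTED TO
THE LEGENDRE FAMILY over a mono-complex `L`, from the second printed line (R3)**: if (R3) holds for every
`λ ∈ L^⑂` and every `0 < ε ≤ 1`, then for every `ε′ > 0` there is a constant `C = C(L, ε′)` — explicitly `C =
2^{12d}·Δ_L^{6(1+ε)}·exp(d·h_d(ε))` with `ε = min{1, ε′/6}` — such that `N_{L/ℚ}(𝔇_{E_λ}) ≤ C·N_{L/ℚ}(𝔣_{E_λ})^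
{6+ε′}` for all `λ ≠ 0, 1` (`N(𝔣) ≥ 1` and `6(1+ε) ≤ 6 + ε′`). This is the exact sense of the printed sentence
"This may be regarded as an explicit version of the inequality … conjectured in [Szp], §1, CONJECTURE 1
forme forte, in the case of `L` and `E_λ` as above" (p. 223 l. 1–4); the full conjecture quantifies over all
elliptic `W/L`. A conditional theorem: it discharges nothing it binds; no Szpiro claim.
[cite: MochizukiEtAl2022, Rmk 5.3.3 p. 223 l. 1–4] [cite: Silverman1994, Conj. IV.10.6] -/
theorem szpiroShape_legendre_of_rmk533Product (hL : IsMonoComplex L)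
    (H : ∀ (lam : L) (ε : ℝ), Rmk533Product L lam ε) :
    ∀ ε' : ℝ, 0 < ε' → ∃ C : ℝ, ∀ lam : L, lam ≠ 0 → lam ≠ 1 →
      (((⟨0, -(1 + lam), 0, lam, 0⟩ : WeierstrassCurve L).minimalDiscriminantNorm (𝓞 L) : ℕ) : ℝ) ≤
        C * (((⟨0, -(1 + lam), 0, lam, 0⟩ : WeierstrassCurve L).conductorNorm (𝓞 L) : ℕ) : ℝ) ^ (6 + ε') := by
  intro ε' hε'
  set ε := min 1 (ε' / 6) with hεdef
  have hε : 0 < ε := lt_min one_pos (by linarith)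
  have hε1 : ε ≤ 1 := min_le_left _ _
  have hε6 : 6 * (1 + ε) ≤ 6 + ε' := by have := min_le_right 1 (ε' / 6); linarith
  refine ⟨(2 : ℝ) ^ (12 * Module.finrank ℚ L) * (absDisc L : ℝ) ^ (6 * (1 + ε)) *
    Real.exp ((Module.finrank ℚ L : ℝ) * hd (Module.finrank ℚ L) ε), fun lam h0 h1 => ?_⟩
  have h := H lam ε hL h0 h1 hε hε1
  rw [legendreMinDiscNorm_def, legendreCondNorm_def] at h
  have hN : (1 : ℝ) ≤ (((⟨0, -(1 + lam), 0, lam, 0⟩ : WeierstrassCurve L).conductorNorm (𝓞 L) : ℕ) : ℝ) := by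
    exact_mod_cast legendreCondNorm_pos lam
  have hpow : (((⟨0, -(1 + lam), 0, lam, 0⟩ : WeierstrassCurve L).conductorNorm (𝓞 L) : ℕ) : ℝ) ^ (6 * (1 + ε)) ≤
      (((⟨0, -(1 + lam), 0, lam, 0⟩ : WeierstrassCurve L).conductorNorm (𝓞 L) : ℕ) : ℝ) ^ (6 + ε') :=
    Real.rpow_le_rpow_of_exponent_le hN hε6
  exact h.trans (mul_le_mul_of_nonneg_left hpow (by positivity))

end ExpEst

end Literature.IUT.LogVolume
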